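import Summits.QuantumAdvantage.QuantumAdvantage.Theorems.SosSandwichTransferPBDescent
import HarnessLib

/-!
# Crux `TransferPB` (stmt-QuantumAdvantage-15238, route SosSandwich), line `birth` — the descent computes EXACTLY the derived advisor

`Theorems/SosSandwichTransferPBMachineDefs.lean` fixed the advisor `derivedAdvisor F x g` (least-INDEX free
kept bit, `Fin.find`); `Theorems/SosSandwichTransferPBDescentDefs.lean` fixed the reference ALGORITHM
`descentAdvisor F x g` (heavy-prefix descent, candidate of least canonical number `strNum`, `List.argmin`).
Since the tree numbers the relevant bits by `strNum` (`bitEquiv_apply`), the two coincide for EVERY answer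
function `g`:

* `descentPick_eq_of_pick_some`, `kept_of_descentAdvisor_pick` — a pick of the descent advisor is a kept bit
  whose string is the descent's pick;
* `descentAdvisor_pick_eq` — the picks agree (strNum-minimality among candidates = index-minimality among free
  kept bits);
* **`descentAdvisor_eq_derivedAdvisor`** — `descentAdvisor F x g = derivedAdvisor F x g`.

Hence the machine targets (M') of `Theorems/SosSandwichTransferPBMachineSplitKept.lean`
(`stub_pbOracleSimulation_of_nodeProblem_consistent`) and (M_desc) of `Theorems/SosSandwichTransferPBDescent.lean`
(`stub_pbOracleSimulation_of_descentMachines`) are the same statement. All proved.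
Source: S. Aaronson, A. Ambainis, Theory Comput. 10 (2014), proof of Thm. 23 (p. 14: the least-index rule is
machine-implementable through an explicit numbering of the oracle strings).
-/

-- D-0017: single-conjunct summit ⇒ the duplicate `QuantumAdvantage.QuantumAdvantage` is mandated.
set_option linter.dupNamespace false

noncomputable section

namespace Summit.QuantumAdvantage.QuantumAdvantage.Cruxes.TransferPB.Birth

open Finset Literature.Computability.Cryptography Literature.Computability.Complexity
  Literature.Computability.QuantumComplexity Literature.Computability.QuantumComplexity.ClassicalSimulation

namespace SimTreePB

variable {F : QCircuitFamily cliffordT} {x : List Bool} {g : List Bool → Bool}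

/-- The canonical number of a relevant bit's string is its index. [folklore] -/
theorem strNum_bitString (s : Fin (numOracleBits F x)) : strNum (bitString F x s) = s :=
  strNum_bitEquiv_symm F x s

/-- A pick of the descent advisor names the descent's picked string. [folklore] -/
theorem descentPick_eq_of_pick_some {ρ : List (Fin (numOracleBits F x) × Bool)} {s : Fin (numOracleBits F x)}
    (h : (descentAdvisor F x g).pick ρ = some s) :
    descentPick (fun u => g (encBlock F x ρ u)) (fun u => g (encSingleStr F x ρ u)) (oracleWidth F x)
        (ρ.map fun e => bitString F x e.1) = some (bitString F x s) := by
  unfold descentAdvisor at h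
  dsimp only at h
  split at h
  · exact absurd h (by simp)
  · rename_i u hu
    split_ifs at h with hW
    simp only [Option.some.injEq] at h
    subst h
    rw [hu, bitString_bitEquiv hW]

/-- A pick of the descent advisor is a `Kept` bit. [folklore] -/
theorem kept_of_descentAdvisor_pick {ρ : List (Fin (numOracleBits F x) × Bool)} {s : Fin (numOracleBits F x)}
    (h : (descentAdvisor F x g).pick ρ = some s) : Kept F x g ρ s := by
  obtain ⟨-, hpre, hsgl, -⟩ := descentPick_some_spec (descentPick_eq_of_pick_some h)
  exact ⟨hpre, by rw [encSingle_eq_encSingleStr]; exact hsgl⟩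

/-- **The picks of the descent advisor and of the derived advisor agree** (for EVERY `g`). [folklore] -/
theorem descentAdvisor_pick_eq (ρ : List (Fin (numOracleBits F x) × Bool)) :
    (descentAdvisor F x g).pick ρ = (derivedAdvisor F x g).pick ρ := by
  classical
  cases hd : (descentAdvisor F x g).pick ρ with
  | none =>
    have hnk := descentAdvisor_pick_none hd
    unfold derivedAdvisor
    dsimp only
    rw [dif_neg]
    rintro ⟨s, hs, hk⟩
    exact hnk s hs hk
  | some s =>
    obtain ⟨hfree, -⟩ := descentAdvisor_pick_some hd
    have hkept := kept_of_descentAdvisor_pick hd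
    have hdp := descentPick_eq_of_pick_some hd
    have hex : ∃ s' : Fin (numOracleBits F x), s' ∉ ρ.map Prod.fst ∧ Kept F x g ρ s' := ⟨s, hfree, hkept⟩
    unfold derivedAdvisor
    dsimp only
    rw [dif_pos hex, Option.some.injEq, eq_comm, Fin.find_eq_iff]
    refine ⟨⟨hfree, hkept⟩, fun j hj hpj => ?_⟩
    -- the string of `j` is a candidate, so the descent's pick has a smaller-or-equal number
    have hcand : bitString F x j ∈ descentCands (fun u => g (encBlock F x ρ u)) (fun u => g (encSingleStr F x ρ u))
        (oracleWidth F x) (ρ.map fun e => bitString F x e.1) :=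
      mem_descentCands_iff.2 ⟨length_bitString_lt j, mem_liveLevel_of_prefixes _ hpj.2.1,
        by rw [← encSingle_eq_encSingleStr]; exact hpj.2.2, by rw [mem_map_bitString_iff]; exact hpj.1⟩
    have hle := strNum_descentPick_le hdp hcand
    rw [strNum_bitString, strNum_bitString] at hle
    exact absurd (Fin.lt_def.1 hj) (not_lt.2 hle)

/-- Advisors are determined by their two fields. [folklore] -/
theorem Advisor.ext_pick_val {N : ℕ} {A B : Advisor N} (h1 : A.pick = B.pick) (h2 : A.val = B.val) : A = B := by
  cases A
  cases B
  simp only at h1 h2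
  subst h1
  subst h2
  rfl

/-- **The heavy-prefix descent computes exactly the derived advisor**: `descentAdvisor F x g = derivedAdvisor F x g`
for every answer function `g`. [cite: AaronsonAmbainis2014, Thm. 23 (proof, p. 14)] -/
theorem descentAdvisor_eq_derivedAdvisor (g : List Bool → Bool) : descentAdvisor F x g = derivedAdvisor F x g :=
  Advisor.ext_pick_val (funext descentAdvisor_pick_eq) (funext fun ρ => by rw [descentAdvisor_val_eq]; rfl)

end SimTreePB

end Summit.QuantumAdvantage.QuantumAdvantage.Cruxes.TransferPB.Birth

end
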